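import Literature.AlgebraicGeometry.ModuliOfAbelianVarieties.Lan2013.Sec723MinimalCompactificationConstruction
import Literature.AlgebraicGeometry.ModuliOfAbelianVarieties.Lan2013.Sec72MinimalCompactifications
import Literature.AlgebraicGeometry.Morphisms.QuasiProjectiveMorphism
import Literature.AlgebraicGeometry.Motives.GoodReductionSpecialFibreProofs
import Literature.AlgebraicGeometry.Resolution.NormalSectionsIntegrallyClosed
import Mathlib.AlgebraicGeometry.FunctionField
import Mathlib.RingTheory.IntegralClosure.IntegrallyClosed
import HarnessLib

/-!
# [Lan2013] §7.2.3 carpet — the DISCHARGE of Lemma 7.2.3.1 and BRIDGES to Theorem 7.2.4.1 (theorem-only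
# companion of `Sec723MinimalCompactificationConstruction.lean`)

Topic `AlgebraicGeometry/ModuliOfAbelianVarieties/Lan2013`, namespace
`Literature.AlgebraicGeometry.ModuliOfAbelianVarieties.Lan2013.Sec723MinimalCompactificationConstruction` (same as the
carpet).  THEOREMS ONLY (D-0014; no `def`, no named fact, no `sorry`, no `instance`, no notation; squad TS RULING TS-1
«one theorem-only companion `<Stem>Holds.lean` per carpet»).  The book restates parts of §7.2.3 inside Theorem 7.2.4.1
(★ `Sec72MinimalCompactifications.Lan2013_7241_part1` … `_part5`, typed by TS-t08 on the same interface
★ `Sec72Defs.MinimalCompactificationTower`); the §7.2.3 items that are CITED rather than re-vendored in the carpet are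
derived here by kernel proofs, so that consumers holding `(h : Lan2013_7241_partN 𝔇 H)` get the §7.2.3 forms for free:

* `Lan2013_7233_of_7241_part1` — Prop. 7.2.3.3 (p. 459) «`𝖬^min_H` is normal» = clause 1 of Thm. 7.2.4.1 1.
* `coarse_isQuasiProjective_of_7241_part1` — Cor. 7.2.3.10 (p. 461), FIRST sentence «the coarse moduli space `[𝖬_H]` of
  `𝖬_H` is a quasi-projective scheme over `S₀`», read on the tower's carrier `𝔇.coarse H`: from Thm. 7.2.4.1 1 (`𝖬^min_H`
  projective over `S₀`, `[𝖬_H] ↪ 𝖬^min_H` an open immersion) by ★ `Morphisms.IsQuasiProjective.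
  of_isOpenImmersion_comp_isProjective` — exactly the printed proof («`[𝖬_H]` is an open sub-algebraic space in
  `𝖬^min_H` … a sub-algebraic space of a projective scheme is a scheme»).  (The SECOND sentence at neat principal level
  over the real moduli functor is ★ `Sec723QuasiProjectivity.Lan2013_Cor72310_quasiProjective`, squad TL.)
* `stratumImage_eq_stratumSet` — the definition `Z_{[(Φ_H, δ_H)]} := image(∮_H|_{Z_{[(Φ_H, δ_H, σ)]}})` (carpet
  `stratumImage`) agrees with the tower's stratum `𝔇.stratumSet H [(Φ_H, δ_H)]` (range of `𝔇.strat`) under Thm. 7.2.4.1 5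
  (`∮_H|_{Z_{[(Φ_H, δ_H, σ)]}}` factors through `[𝖬_H^{Z_H}] → 𝖬^min_H` by a surjection).
* `Lan2013_723_imageOfLabel_of_7241_part5` — «same cusp label ⇒ same image» from Thm. 7.2.4.1 5.
* `Lan2013_7237_of_7241` — Prop. 7.2.3.7 (p. 461) from Thm. 7.2.4.1 4 (each point lies in exactly one stratum) and 5.

ED. 2 (append protocol) DISCHARGES the carpet's one closed fact:

* `Lan2013_7231_holds : Lan2013_7231` — **Lemma 7.2.3.1 (p. 459)**: normality descends along a quasi-compact surjection
  `f : Z₁ → Z₂` with `𝒪_{Z₂} ⥲ f_* 𝒪_{Z₁}` (`Z₁` locally noetherian, as typed).  KERNEL PROOF, following the printed idea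
  («the local rings of `Z₂` are domains … normalization») in the form it takes on scheme carriers: for `y = f(z)` choose an
  affine open `U₁ ∋ y`; an irreducible open neighbourhood `N` of `z` inside `f⁻¹U₁` exists because `𝒪_{Z₁,z}` is a domain
  (★ `Motives.exists_isOpen_isIrreducible_of_isDomain_stalk`, EGA I 6.1.9–6.1.10), and `T := ̅N ∩ f⁻¹U₁` is OPEN (every
  point of `T` has an irreducible open neighbourhood meeting `N`, hence inside `̅N`), closed in `f⁻¹U₁` and irreducible
  (`exists_isAffineOpen_isIrreducible_preimage`); the sheaf glues the section `e` of `𝒪_{Z₁}` over `f⁻¹U₁` which is `1`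
  on `T` and `0` off `T` (`exists_section_one_zero`, Mathlib `TopCat.Sheaf.objSupIsoProdEqLocus`), whose unit locus is
  exactly `T` (`basicOpen_eq_of_one_zero`); by surjectivity of `f♯` on sections `e = f♯(ε)` with `ε ∈ Γ(Z₂, U₁)`, and the
  affine open `U := D(ε) ⊆ U₁` has `f⁻¹U = D(f♯ε) = T` (Mathlib `Scheme.preimage_basicOpen`) — irreducible and containing
  `z`, so `y ∈ U`.  Then the open subscheme `V := f⁻¹U` is INTEGRAL (irreducible, and reduced because its local rings are
  domains) with integrally closed local rings, so `Γ(V, 𝒪_V)` is an integrally closed domain (★ `Resolution.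
  isIntegrallyClosedIn_sections`, Stacks 0358, with Mathlib `IsIntegrallyClosed.of_isIntegrallyClosedIn`); `Γ(Z₂, U) ≅
  Γ(Z₁, f⁻¹U) ≅ Γ(V, 𝒪_V)` by the bijectivity of `f♯` (`RingEquiv.ofBijective`) and `Scheme.Opens.topIso`; and
  `𝒪_{Z₂,y}` is the localisation of this integrally closed domain at a prime (Mathlib `IsAffineOpen.isLocalization_stalk`),
  hence an integrally closed domain (`IsLocalization.isDomain_of_le_nonZeroDivisors`, `isIntegrallyClosed_of_isLocalization`).
  Net debt delta −1 (the carpet's `+1` is repaid).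

ED. 3 (AUTHOR'S ERRATA, docstring riders only — every declaration byte-identical; squad RULING TS-4 (d) ∕ TS-5 (3), seat
TS-t06 (g4)): the author's published errata list (K.-W. Lan, «Arithmetic compactifications of PEL-type Shimura varieties —
Errata», dated 2021-03-14, bib key `Lan2013PELCompactificationsErrata`; squad concordance
`lit/lit7/g2/ERRATA-Lan2013-PUP-author-20210314.lit7g2.md`, entries (81)–(82) read from that transcription) rewords the two
parts of Thm. 7.2.4.1 that the bridges below consume BY NAME: (81) «In 4. of Thm. 7.2.4.1, should simply say that `𝖬_H^{Z_H}` is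
as in Definition 5.4.2.6, without saying that it represents a moduli problem»; (82) «In 5. of Thm. 7.2.4.1, should say instead
that `C_{Φ_H,δ_H}` is an abelian scheme torsor over the finite étale cover `𝖬_H^{Φ_H}` over the algebraic stack `𝖬_H^{Z_H}` over
the coarse moduli space `[𝖬_H^{Z_H}]` (which is a scheme)».  Both are AMBER (wording) here: the hypotheses
★ `Sec72MinimalCompactifications.Lan2013_7241_part4` (immersions of the strata, partition, incidence) and `_part5` (the
restriction of `∮_H` to a toroidal stratum factors through `[𝖬_H^{Z_H}] → 𝖬^min_H` by a proper smooth surjection) never used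
the moduli interpretation of `𝖬_H^{Z_H}` nor the abelian-scheme description of `C_{Φ_H,δ_H}` (their own docstrings carry the
corrected quotations since their ED. 2, `[cite: Lan2013PELCompactificationsErrata, no. 81 ∕ 82]`); the three bridge theorems
`stratumImage_eq_stratumSet`, `Lan2013_723_imageOfLabel_of_7241_part5`, `Lan2013_7237_of_7241` are therefore unchanged in
statement and proof, and their docstrings now name the errata entries.

## References
* [Lan2013PELCompactifications] K.-W. Lan, *Arithmetic compactifications of PEL-type Shimura varieties*, LMS Monographs
  36 (2013): Lem. 7.2.3.1 p. 459, Prop. 7.2.3.3 p. 459, Prop. 7.2.3.7 p. 461, Cor. 7.2.3.10 p. 461, Thm. 7.2.4.1 p. 464.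
* [Lan2013PELCompactificationsErrata] K.-W. Lan, *Arithmetic compactifications of PEL-type Shimura varieties — Errata*
  (author's list dated 2021-03-14), nos. 81, 82 (p. 5), via the squad concordance `lit/lit7/g2/ERRATA-Lan2013-PUP-author-
  20210314.lit7g2.md`.
* [StacksProject] Tag 0358 (sections of a normal integral scheme form a normal domain), Tag 033M, Tag 0357 (locally
  Noetherian schemes with integral local rings); EGA I (1971) Cor. 6.1.9–6.1.10.
-/

noncomputable section

open CategoryTheory CategoryTheory.Limits AlgebraicGeometry TopologicalSpace Opposite

universe u

namespace Literature.AlgebraicGeometry.ModuliOfAbelianVarieties.Lan2013.Sec723MinimalCompactificationConstruction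

open Literature.AlgebraicGeometry.ModuliOfAbelianVarieties.Lan2013.Sec72Defs
open Literature.AlgebraicGeometry.ModuliOfAbelianVarieties.Lan2013.Sec72MinimalCompactifications

variable {R : Type u} [CommRing R] {GA : Type u} [Group GA] {𝔇 : MinimalCompactificationTower R GA} {H : Subgroup GA}

/-- **Prop. 7.2.3.3 («`𝖬^min_H` is normal») from Thm. 7.2.4.1 1** (its first clause).
[cite: Lan2013PELCompactifications, Prop. 7.2.3.3 (p. 459)] -/
theorem Lan2013_7233_of_7241_part1 (h : Lan2013_7241_part1 𝔇 H) : IsNormalScheme (𝔇.min H).left :=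
  h.1

/-- **Cor. 7.2.3.10, first sentence («`[𝖬_H]` is a quasi-projective scheme over `S₀`»), on the tower, from Thm. 7.2.4.1 1**:
`[𝖬_H] → S₀` is the open immersion `[𝖬_H] ↪ 𝖬^min_H` followed by the projective `𝖬^min_H → S₀`.
[cite: Lan2013PELCompactifications, Cor. 7.2.3.10 (p. 461)] -/
theorem coarse_isQuasiProjective_of_7241_part1 (h : Lan2013_7241_part1 𝔇 H) :
    Morphisms.IsQuasiProjective (𝔇.coarse H).hom := by
  obtain ⟨-, hproj, -, hopen, -⟩ := h
  rw [← Over.w (𝔇.jmin H)]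
  exact Morphisms.IsQuasiProjective.of_isOpenImmersion_comp_isProjective _ hproj

/-- **`Z_{[(Φ_H, δ_H)]}` as the image of a toroidal stratum IS the tower's stratum of its cusp label**, given Thm. 7.2.4.1 5:
`image(∮_H|_{Z_{[(Φ_H, δ_H, σ)]}}) = image([𝖬_H^{Z_H}] → 𝖬^min_H)` because the first map factors through the second by a
surjection.  (Part 5 is quoted AS TYPED by ★ `Lan2013_7241_part5` — its first sentence; the author's errata (2021-03-14)
no. 82 rewords the rest of part 5 — `C_{Φ_H,δ_H}` is an abelian scheme torsor over the finite étale cover `𝖬_H^{Φ_H}` of the stack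
`𝖬_H^{Z_H}` over the scheme `[𝖬_H^{Z_H}]` — which this bridge does not use.)
[cite: Lan2013PELCompactifications, Thm. 7.2.4.1 5 (p. 464); author's errata (2021-03-14) no. 82]
[cite: Lan2013PELCompactificationsErrata, no. 82] -/
theorem stratumImage_eq_stratumSet (h5 : Lan2013_7241_part5 𝔇 H) (D : 𝔇.Tor H) (τ : 𝔇.TorCusp H D) :
    stratumImage 𝔇 H D τ = 𝔇.stratumSet H (𝔇.torCuspLabel H D τ) := by
  obtain ⟨r, hr, -, -, hsurj⟩ := h5 D τ
  have key : ((𝔇.torStrat H D τ ≫ 𝔇.stein H D).left.base : (𝔇.torStratum H D τ).left → (𝔇.min H).left) =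
      (𝔇.strat H (𝔇.torCuspLabel H D τ)).left.base ∘ r.left.base := by
    rw [← hr]
    rfl
  unfold stratumImage MinimalCompactificationTower.stratumSet
  rw [key, Set.range_comp, hsurj.surj.range_eq, Set.image_univ]

/-- **«Same cusp label ⇒ same image» (`Lan2013_723_imageOfLabel`) from Thm. 7.2.4.1 5** (first sentence of part 5, as
typed by ★ `Lan2013_7241_part5`; the torsor description of `C_{Φ_H,δ_H}` corrected by the author's errata (2021-03-14) no. 82 is
not used). [cite: Lan2013PELCompactifications, §7.2.3 (p. 461)] [cite: Lan2013PELCompactificationsErrata, no. 82] -/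
theorem Lan2013_723_imageOfLabel_of_7241_part5 (h5 : Lan2013_7241_part5 𝔇 H) :
    Lan2013_723_imageOfLabel 𝔇 H := by
  intro D τ τ' hlab
  rw [stratumImage_eq_stratumSet h5, stratumImage_eq_stratumSet h5, hlab]

/-- **Prop. 7.2.3.7 from Thm. 7.2.4.1 4 and 5**: if the images of two toroidal strata meet at a point `y`, then `y` lies in
the strata of both cusp labels, which coincide because every point of `𝖬^min_H` lies in exactly one stratum.  (Parts 4 and 5
are used AS TYPED by ★ `Lan2013_7241_part4` ∕ `_part5` — immersions of the strata with the partition property, and the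
factorisation of `∮_H` on a toroidal stratum; the author's errata (2021-03-14) nos. 81–82, which stop calling `𝖬_H^{Z_H}` a
moduli problem and make `C_{Φ_H,δ_H} → 𝖬_H^{Φ_H}` an abelian scheme torsor, do not touch these clauses.)
[cite: Lan2013PELCompactifications, Prop. 7.2.3.7 (p. 461)] [cite: Lan2013PELCompactificationsErrata, no. 81 ∕ 82] -/
theorem Lan2013_7237_of_7241 (h4 : Lan2013_7241_part4 𝔇 H) (h5 : Lan2013_7241_part5 𝔇 H) :
    Lan2013_7237 𝔇 H := by
  intro D τ τ' hne
  obtain ⟨y, hy, hy'⟩ := hne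
  rw [stratumImage_eq_stratumSet h5] at hy hy'
  obtain ⟨c, -, huniq⟩ := h4.2.1 y
  exact (huniq _ hy).trans (huniq _ hy').symm

/-! ## Lemma 7.2.3.1 — the discharge (ED. 2) -/

/-- **Gluing `1` and `0` over disjoint opens**: on a scheme `X`, for opens `T`, `T'` with `T ⊓ T' = ⊥` there is a section of
`𝒪_X` over `T ⊔ T'` restricting to `1` on `T` and to `0` on `T'` (the sheaf condition for the cover `{T, T'}`, Mathlib
`TopCat.Sheaf.objSupIsoProdEqLocus`; sections over `⊥` form the terminal ring).  Private helper. [folklore] -/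
private theorem exists_section_one_zero (X : Scheme.{u}) (T T' : X.Opens) (h : T ⊓ T' = ⊥) :
    ∃ e : Γ(X, T ⊔ T'), X.presheaf.map (homOfLE le_sup_left).op e = 1 ∧
      X.presheaf.map (homOfLE le_sup_right).op e = 0 := by
  haveI : Subsingleton (X.sheaf.obj.obj (op (T ⊓ T'))) :=
    CommRingCat.subsingleton_of_isTerminal (X.sheaf.isTerminalOfEqEmpty h)
  refine ⟨(X.sheaf.objSupIsoProdEqLocus T T').inv ⟨((1 : Γ(X, T)), (0 : Γ(X, T'))), Subsingleton.elim _ _⟩,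
    ?_, ?_⟩
  · exact X.sheaf.objSupIsoProdEqLocus_inv_fst T T' _
  · exact X.sheaf.objSupIsoProdEqLocus_inv_snd T T' _

/-- **The unit locus of the glued section is exactly `T`**: its germs are `1` on `T` and `0` on `T'` (and local rings of a
scheme are nontrivial).  Private helper. [folklore] -/
private theorem basicOpen_eq_of_one_zero (X : Scheme.{u}) (T T' : X.Opens) (e : Γ(X, T ⊔ T'))
    (h1 : X.presheaf.map (homOfLE le_sup_left).op e = 1) (h0 : X.presheaf.map (homOfLE le_sup_right).op e = 0) :
    X.basicOpen e = T := by
  apply le_antisymm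
  · intro x hx
    obtain ⟨hxW, hu⟩ := (X.mem_basicOpen'' e x).mp hx
    rcases Opens.mem_sup.mp hxW with hxT | hxT'
    · exact hxT
    · exfalso
      have hgerm : X.presheaf.germ (T ⊔ T') x hxW e = 0 := by
        rw [← TopCat.Presheaf.germ_res_apply X.presheaf (homOfLE (le_sup_right : T' ≤ T ⊔ T')) x hxT', h0,
          map_zero]
      rw [hgerm] at hu
      exact not_isUnit_zero hu
  · intro x hxT
    refine (X.mem_basicOpen'' e x).mpr ⟨le_sup_left (b := T') hxT, ?_⟩
    rw [← TopCat.Presheaf.germ_res_apply X.presheaf (homOfLE (le_sup_left : T ≤ T ⊔ T')) x hxT, h1, map_one]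
    exact isUnit_one

/-- **Key lemma for Lem. 7.2.3.1** (the scheme-carrier form of «the local rings of `Z₂` are domains»): let `f : Z₁ → Z₂`
be a morphism with `Z₁` locally noetherian, all of whose local rings are domains, and with `f♯ : Γ(Z₂, U) → Γ(Z₁, f⁻¹U)`
surjective for every open `U`.  Then every `z ∈ Z₁` lies over an AFFINE open `U ∋ f(z)` of `Z₂` whose preimage `f⁻¹U` is
IRREDUCIBLE.  Proof: inside the preimage `f⁻¹U₁` of an affine open `U₁ ∋ f(z)` take an irreducible open neighbourhood `N` of
`z` (★ `Motives.exists_isOpen_isIrreducible_of_isDomain_stalk`); `T := closure(N) ∩ f⁻¹U₁` is open (each of its points has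
an irreducible open neighbourhood meeting `N`, which therefore lies in `closure(N)`:
`subset_closure_inter_of_isPreirreducible_of_isOpen`), so `{T, f⁻¹U₁ ∖ closure(N)}` is an open partition of `f⁻¹U₁`; glue the
section `e` (`1` on `T`, `0` off `T`), write `e = f♯(ε)` over `U₁`, and take `U := D(ε)`: it is affine
(`IsAffineOpen.basicOpen`) and `f⁻¹U = D(f♯ε) = D(e) = T` (`Scheme.preimage_basicOpen`, `basicOpen_eq_of_one_zero`), an open
subset of the irreducible `closure(N)` containing `z`. [cite: Lan2013PELCompactifications, Lem. 7.2.3.1 (p. 459)] -/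
theorem exists_isAffineOpen_isIrreducible_preimage {Z₁ Z₂ : Scheme.{u}} (f : Z₁ ⟶ Z₂) [IsLocallyNoetherian Z₁]
    (hdom : ∀ z : Z₁, IsDomain (Z₁.presheaf.stalk z))
    (hsurj : ∀ U : Z₂.Opens, Function.Surjective (f.app U)) (z : Z₁) :
    ∃ U : Z₂.Opens, IsAffineOpen U ∧ z ∈ f ⁻¹ᵁ U ∧ IsIrreducible (f ⁻¹ᵁ U : Set Z₁) := by
  obtain ⟨U₁, hU₁, hzU₁, -⟩ :=
    exists_isAffineOpen_mem_and_subset (X := Z₂) (x := f.base z) (U := ⊤) trivial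
  set V₁ : Z₁.Opens := f ⁻¹ᵁ U₁ with hV₁def
  have hzV₁ : z ∈ V₁ := hzU₁
  -- an irreducible open neighbourhood of `z` inside `V₁`
  haveI := hdom z
  obtain ⟨N₀, hN₀o, hzN₀, hN₀i⟩ :=
    Literature.AlgebraicGeometry.Motives.exists_isOpen_isIrreducible_of_isDomain_stalk Z₁ z
  set N : Set Z₁ := N₀ ∩ (V₁ : Set Z₁) with hNdef
  have hNo : IsOpen N := hN₀o.inter V₁.2
  have hzN : z ∈ N := ⟨hzN₀, hzV₁⟩
  have hNi : IsIrreducible N := ⟨⟨z, hzN⟩, hN₀i.2.open_subset hNo Set.inter_subset_left⟩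
  -- `T := closure N ∩ V₁` is open
  set T : Set Z₁ := closure N ∩ (V₁ : Set Z₁) with hTdef
  have hTo : IsOpen T := by
    rw [isOpen_iff_forall_mem_open]
    rintro t ⟨htN, htV₁⟩
    haveI := hdom t
    obtain ⟨Nt, hNto, htNt, hNti⟩ :=
      Literature.AlgebraicGeometry.Motives.exists_isOpen_isIrreducible_of_isDomain_stalk Z₁ t
    have hmeet : (Nt ∩ N).Nonempty := mem_closure_iff.mp htN Nt hNto htNt
    have hsub : Nt ⊆ closure N :=
      (subset_closure_inter_of_isPreirreducible_of_isOpen hNti.2 hNo hmeet).trans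
        (closure_mono Set.inter_subset_right)
    exact ⟨Nt ∩ (V₁ : Set Z₁), fun w hw => ⟨hsub hw.1, hw.2⟩, hNto.inter V₁.2, ⟨htNt, htV₁⟩⟩
  let TO : Z₁.Opens := ⟨T, hTo⟩
  let T'O : Z₁.Opens := ⟨(V₁ : Set Z₁) \ closure N, V₁.2.sdiff isClosed_closure⟩
  have hsup : TO ⊔ T'O = V₁ := by
    ext w
    simp only [Opens.coe_sup, Set.mem_union, SetLike.mem_coe]
    change (w ∈ T ∨ w ∈ (V₁ : Set Z₁) \ closure N) ↔ w ∈ V₁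
    constructor
    · rintro (⟨-, hw⟩ | ⟨hw, -⟩) <;> exact hw
    · intro hw
      by_cases hc : w ∈ closure N
      · exact Or.inl ⟨hc, hw⟩
      · exact Or.inr ⟨hw, hc⟩
  have hinf : TO ⊓ T'O = ⊥ := by
    ext w
    simp only [Opens.coe_inf, Set.mem_inter_iff, SetLike.mem_coe, Opens.coe_bot, Set.mem_empty_iff_false, iff_false]
    change ¬ (w ∈ T ∧ w ∈ (V₁ : Set Z₁) \ closure N)
    rintro ⟨⟨hc, -⟩, ⟨-, hc'⟩⟩
    exact hc' hc
  -- the section `e`: `1` on `T`, `0` off `T`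
  obtain ⟨e, he1, he0⟩ := exists_section_one_zero Z₁ TO T'O hinf
  have hbe : Z₁.basicOpen e = TO := basicOpen_eq_of_one_zero Z₁ TO T'O e he1 he0
  let e' : Γ(Z₁, V₁) := Z₁.presheaf.map (homOfLE hsup.ge).op e
  have hbe' : Z₁.basicOpen e' = TO := by
    rw [Scheme.basicOpen_res, hbe]
    exact inf_eq_right.mpr ((le_sup_left : TO ≤ TO ⊔ T'O).trans hsup.le)
  obtain ⟨ε, hε⟩ := hsurj U₁ e'
  refine ⟨Z₂.basicOpen ε, hU₁.basicOpen ε, ?_, ?_⟩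
  · rw [Scheme.preimage_basicOpen, hε, hbe']
    exact ⟨subset_closure hzN, hzV₁⟩
  · rw [Scheme.preimage_basicOpen, hε, hbe']
    exact ⟨⟨z, subset_closure hzN, hzV₁⟩, hNi.closure.2.open_subset hTo Set.inter_subset_left⟩

/-- **Lemma 7.2.3.1 HOLDS** (as typed: `Z₁` locally noetherian): «Let `f : Z₁ → Z₂` be a quasi-compact surjection … such
that `𝒪_{Z₂} → f_* 𝒪_{Z₁}` is an isomorphism.  Suppose `Z₁` is normal.  Then `Z₂` is also normal.»  For `y = f(z)` the key
lemma gives an affine open `U ∋ y` with `V := f⁻¹U` irreducible; `V` is reduced (its local rings are domains), hence an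
integral scheme whose local rings (`Scheme.Opens.stalkIso`) are integrally closed, so `Γ(V, 𝒪_V)` is an integrally closed
domain (★ `Resolution.isIntegrallyClosedIn_sections` + `IsIntegrallyClosed.of_isIntegrallyClosedIn`); it is isomorphic to
`Γ(Z₂, U)` through the bijective `f♯` (`RingEquiv.ofBijective`, `Scheme.Opens.topIso`), and `𝒪_{Z₂,y}` is a localisation of
`Γ(Z₂, U)` at a prime (`IsAffineOpen.isLocalization_stalk`), hence an integrally closed domain
(`IsLocalization.isDomain_of_le_nonZeroDivisors`, `isIntegrallyClosed_of_isLocalization`).  Quasi-compactness of `f` is not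
used. [cite: Lan2013PELCompactifications, Lem. 7.2.3.1 (p. 459; 2010 rev. p. 515)] -/
theorem Lan2013_7231_holds : Lan2013_7231.{u} := by
  intro Z₁ Z₂ f _ _ _ hSt hN y
  have hdom : ∀ z : Z₁, IsDomain (Z₁.presheaf.stalk z) := fun z => (hN z).1
  obtain ⟨z, rfl⟩ := f.surjective y
  obtain ⟨U, hU, hzU, hirr⟩ := exists_isAffineOpen_isIrreducible_preimage f hdom (fun U => (hSt U).2) z
  -- the open subscheme `V = f⁻¹U` is integral with integrally closed local rings
  set V : Z₁.Opens := f ⁻¹ᵁ U with hVdef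
  haveI : ∀ x : Z₁, _root_.IsReduced (Z₁.presheaf.stalk x) := fun x => by
    haveI := hdom x; infer_instance
  haveI : IsReduced Z₁ := isReduced_of_isReduced_stalk Z₁
  haveI : IsReduced (V : Scheme.{u}) := isReduced_of_isOpenImmersion V.ι
  haveI : IrreducibleSpace (V : Scheme.{u}) := Subtype.irreducibleSpace hirr
  haveI : IsIntegral (V : Scheme.{u}) := isIntegral_of_irreducibleSpace_of_isReduced _
  have hNV : ∀ v : (V : Scheme.{u}), IsIntegrallyClosed ((V : Scheme.{u}).presheaf.stalk v) := fun v => by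
    haveI := (hN v.1).2
    exact IsIntegrallyClosed.of_equiv (V.stalkIso v).commRingCatIsoToRingEquiv.symm
  haveI : Nonempty (⊤ : (V : Scheme.{u}).Opens) := ⟨⟨⟨z, hzU⟩, trivial⟩⟩
  haveI : IsIntegrallyClosedIn Γ((V : Scheme.{u}), ⊤) (V : Scheme.{u}).functionField :=
    Literature.AlgebraicGeometry.Resolution.isIntegrallyClosedIn_sections hNV ⊤
  haveI : FaithfulSMul Γ((V : Scheme.{u}), ⊤) (V : Scheme.{u}).functionField :=
    (faithfulSMul_iff_algebraMap_injective _ _).mpr ((V : Scheme.{u}).germToFunctionField_injective ⊤)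
  have hICV : IsIntegrallyClosed Γ((V : Scheme.{u}), ⊤) :=
    IsIntegrallyClosed.of_isIntegrallyClosedIn Γ((V : Scheme.{u}), ⊤) (V : Scheme.{u}).functionField
  -- transport to `B = Γ(Z₂, U)` along `f♯` (bijective) and `Γ(V, ⊤) ≅ Γ(Z₁, f⁻¹U)`
  let e₁ : Γ(Z₂, U) ≃+* Γ(Z₁, V) := RingEquiv.ofBijective (f.app U).hom (hSt U)
  let eB : Γ(Z₂, U) ≃+* Γ((V : Scheme.{u}), ⊤) := e₁.trans V.topIso.commRingCatIsoToRingEquiv.symm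
  haveI : IsDomain Γ(Z₂, U) := Function.Injective.isDomain eB.toRingHom eB.injective
  haveI : IsIntegrallyClosed Γ(Z₂, U) := by
    haveI := hICV
    exact IsIntegrallyClosed.of_equiv eB.symm
  -- the stalk is a localization of `B` at a prime
  letI := TopCat.Presheaf.algebra_section_stalk Z₂.presheaf (⟨f.base z, hzU⟩ : U)
  haveI hloc := hU.isLocalization_stalk ⟨f.base z, hzU⟩
  set 𝔭 := (hU.primeIdealOf ⟨f.base z, hzU⟩).asIdeal with h𝔭
  refine ⟨?_, ?_⟩
  · exact IsLocalization.isDomain_of_le_nonZeroDivisors (M := 𝔭.primeCompl) _ 𝔭.primeCompl_le_nonZeroDivisors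
  · exact isIntegrallyClosed_of_isLocalization _ 𝔭.primeCompl 𝔭.primeCompl_le_nonZeroDivisors

end Literature.AlgebraicGeometry.ModuliOfAbelianVarieties.Lan2013.Sec723MinimalCompactificationConstruction
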